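import Literature.Analysis.PDE.HeatSlabUniqueness
import Literature.Analysis.FluidPDE.ClassicalSolutionCalculus
import HarnessLib

/-!
# A priori weighted energy estimates for slab solutions of the flat heat equation
# (topic `Analysis/PDE`)

Analytic layer of the programme to prove short-time existence for quasilinear strictly
parabolic systems on a closed manifold (hypothesis `hQL` of
`Literature.Geometry.Riemannian.ricciFlow_shortTime_existence_of_quasilinear`). The a priori
estimates of that programme are estimates of an ARBITRARY function `w : ℝ → E → F'` which is
smooth on the closed slab `[0, T] × E`, vanishes off a compact set in space and at `t = 0`, in
terms of its heat residual

  `slabResidual ν T w = ∂ₜw - νΔw`   (`∂ₜ` within `[0, T]`):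

by the uniqueness theorem on the slab (`HeatSlabUniqueness.lean`) such a `w` IS the
zero-initial-value Duhamel solution of its residual (extended smoothly in time,
`slabExtend`), `w(t) = heatDuhamelZero ν Θ (t)` on `[0, T]`
(`eq_heatDuhamelZero_of_slabResidual`), and therefore every weighted energy estimate of
`HeatZeroEnergy.lean` holds for `w` with the residual on the right
(`lintegral_weight_sobolevEnergy_le_residual`, `…_sum_fderiv_…`, `…_sum_fderiv_fderiv_…`,
`weight_mul_sobolevEnergy_le_residual`, `weight_mul_sum_sobolevEnergy_fderiv_le_residual`):
for every order `k`, `λ`, and `t ∈ [0, T]`,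

  `∫₀ᵗ e^{-2λs} E_k(w) ≤ λ⁻² R`, `∫₀ᵗ e^{-2λs} Σᵢ E_k(∂ᵢw) ≤ (λ⁻¹/2ν) R`,
  `∫₀ᵗ e^{-2λs} Σᵢⱼ E_k(∂ⱼ∂ᵢw) ≤ (n/ν²) R`, `e^{-2λt} E_k(w(t)) ≤ λ⁻¹ R`,
  `e^{-2λt} Σᵢ E_k(∂ᵢw(t)) ≤ (n/ν) R`,  `R = ∫₀ᵗ e^{-2λs} E_k(∂ₜw - νΔw)`.

No partial differential equation is assumed: these are inequalities for smooth functions.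

Everything is proved; no named fact and no `sorry` is introduced.

## References

* L. C. Evans, *Partial Differential Equations*, 2nd ed., AMS 2010, §7.1.2, Thm. 2 and §7.1.3
  (energy estimates; a priori form). [Evans2010]
-/

noncomputable section

open MeasureTheory Set Function Filter Topology TopologicalSpace Metric InnerProductSpace
open scoped RealInnerProductSpace Laplacian ContDiff ENNReal

namespace Literature.Analysis.PDE

open Literature.Analysis.UnboundedOperators Literature.Analysis.FluidPDE
  Literature.Analysis.FunctionSpaces

variable {E : Type*} [NormedAddCommGroup E] [InnerProductSpace ℝ E] [FiniteDimensional ℝ E]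
variable {F' : Type*} [NormedAddCommGroup F'] [InnerProductSpace ℝ F']

variable {ν T : ℝ} {w : ℝ → E → F'} {K : Set E}

/-! ### The heat residual of a slab function -/

/-- **The heat residual** `∂ₜw - νΔw` of `w` on the slab `[0, T]` (time derivative within
`[0, T]`, one-sided at the ends). [cite: Evans2010, §7.1.2] -/
def slabResidual (ν T : ℝ) (w : ℝ → E → F') (t : ℝ) (y : E) : F' :=
  timeDerivWithin (Icc 0 T) w t y - ν • (Δ (w t)) y

/-- `slabResidual_apply`: unfolding. [folklore] -/
theorem slabResidual_apply (ν T : ℝ) (w : ℝ → E → F') (t : ℝ) (y : E) :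
    slabResidual ν T w t y = timeDerivWithin (Icc 0 T) w t y - ν • (Δ (w t)) y := rfl

/-- The residual of a slab-smooth function is slab-smooth. [folklore] -/
theorem isSmoothSpaceTimeOn_slabResidual (hT : 0 < T) (hw : IsSmoothSpaceTimeOn (Icc 0 T) w) :
    IsSmoothSpaceTimeOn (Icc 0 T) (slabResidual ν T w) :=
  (hw.timeDerivWithin (uniqueDiffOn_Icc hT)).sub ((hw.laplacian (uniqueDiffOn_Icc hT)).const_smul ν)

/-- The Laplacian of a function vanishing on an open set vanishes there. [folklore] -/
theorem laplacian_eq_zero_of_eqOn_zero {f : E → F'} {U : Set E} (hU : IsOpen U)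
    (hf : ∀ y ∈ U, f y = 0) {y : E} (hy : y ∈ U) : (Δ f) y = 0 := by
  have hev : f =ᶠ[𝓝 y] fun _ ↦ 0 := eventuallyEq_of_mem (hU.mem_nhds hy) hf
  have h2 : iteratedFDeriv ℝ 2 f y = iteratedFDeriv ℝ 2 (fun _ : E ↦ (0 : F')) y :=
    (hev.iteratedFDeriv ℝ 2).self_of_nhds
  rw [laplacian_eq_iteratedFDeriv_stdOrthonormalBasis]
  simp [h2, iteratedFDeriv_const_of_ne two_ne_zero]

/-- The residual vanishes wherever `w` vanishes identically off a closed set. [folklore] -/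
theorem slabResidual_eq_zero (hK : IsClosed K) (hwK : ∀ s, ∀ y ∉ K, w s y = 0) (t : ℝ) {y : E}
    (hy : y ∉ K) : slabResidual ν T w t y = 0 := by
  rw [slabResidual_apply, timeDerivWithin_apply]
  have h1 : (fun s ↦ w s y) = fun _ ↦ 0 := funext fun s ↦ hwK s y hy
  have h2 : derivWithin (fun _ : ℝ ↦ (0 : F')) (Icc 0 T) t = 0 := by simp
  rw [h1, h2, laplacian_eq_zero_of_eqOn_zero hK.isOpen_compl
    (fun z hz ↦ hwK t z hz) hy, smul_zero, sub_zero]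

/-- The smooth time extension of the residual is a space–time test field. [folklore] -/
theorem isSpaceTimeTestOn_slabExtend_slabResidual [CompleteSpace F'] (hT : 0 < T)
    (hw : IsSmoothSpaceTimeOn (Icc 0 T) w)
    (hK : IsCompact K) (hwK : ∀ s, ∀ y ∉ K, w s y = 0) :
    IsSpaceTimeTestOn (⊤ : Opens (ℝ × E)) (slabExtend T (slabResidual ν T w)) :=
  isSpaceTimeTestOn_slabExtend hT (isSmoothSpaceTimeOn_slabResidual hT hw) hK
    fun s _ hy ↦ slabResidual_eq_zero hK.isClosed hwK s hy

/-! ### Slab functions are the Duhamel solutions of their residuals -/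

variable [MeasurableSpace E] [BorelSpace E] [FiniteDimensional ℝ F']

/-- **A slab function is the zero-initial-value Duhamel solution of its residual**: if `w` is
smooth on `[0, T] × E`, vanishes off a compact set and at `t = 0`, then
`w(t) = heatDuhamelZero ν Θ (t)` on `[0, T]` with `Θ` the smooth time extension of
`∂ₜw - νΔw`. [cite: Evans2010, §7.1.2, Thm. 2] -/
theorem eq_heatDuhamelZero_of_slabResidual (hT : 0 < T) (hν : 0 < ν)
    (hw : IsSmoothSpaceTimeOn (Icc 0 T) w) (hK : IsCompact K) (hwK : ∀ s, ∀ y ∉ K, w s y = 0)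
    (hw0 : ∀ y, w 0 y = 0) {t : ℝ} (ht : t ∈ Icc 0 T) :
    w t = heatDuhamelZero ν (slabExtend T (slabResidual ν T w)) t := by
  have hU : UniqueDiffOn ℝ (Icc 0 T) := uniqueDiffOn_Icc hT
  refine slice_eq_heatDuhamelZero_of_slab hT hν
    (isSpaceTimeTestOn_slabExtend_slabResidual hT hw hK hwK) hw hK hwK hw0 (fun s hs y ↦ ?_) ht
  have h := hw.hasDerivWithinAt_timeDerivWithin hU hs y
  rw [slabExtend_apply_of_mem hs, slabResidual_apply, add_sub_cancel]
  exact h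

/-! ### The a priori weighted estimates -/

omit [FiniteDimensional ℝ F'] in
/-- The right-hand sides agree: on `(0, t) ⊆ [0, T]` the extended residual is the residual.
[folklore] -/
theorem lintegral_weight_sobolevEnergy_slabExtend_eq (k : ℕ) (g : ℝ → ℝ≥0∞) {t : ℝ}
    (ht : t ≤ T) :
    ∫⁻ s in Ioo 0 t, g s * sobolevEnergy k (slabExtend T (slabResidual ν T w) s) =
      ∫⁻ s in Ioo 0 t, g s * sobolevEnergy k (slabResidual ν T w s) := by
  refine setLIntegral_congr_fun measurableSet_Ioo fun s hs ↦ ?_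
  rw [slabExtend_eq_of_mem ⟨hs.1.le, hs.2.le.trans ht⟩]

section Estimates

variable (hT : 0 < T) (hν : 0 < ν) (hw : IsSmoothSpaceTimeOn (Icc 0 T) w) (hK : IsCompact K)
  (hwK : ∀ s, ∀ y ∉ K, w s y = 0) (hw0 : ∀ y, w 0 y = 0)
include hT hν hw hK hwK hw0

/-- **Weighted energy, integrated**: `∫₀ᵗ e^{-2λs} E_k(w) ≤ λ⁻² ∫₀ᵗ e^{-2λs} E_k(∂ₜw - νΔw)`.
[cite: Evans2010, §7.1.2, Thm. 2] -/
theorem lintegral_weight_sobolevEnergy_le_residual {lam : ℝ} (hlam : 0 < lam) (k : ℕ) {t : ℝ}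
    (ht : t ∈ Icc 0 T) :
    ∫⁻ s in Ioo 0 t, ENNReal.ofReal (Real.exp (-2 * lam * s)) * sobolevEnergy k (w s) ≤
      ENNReal.ofReal (lam⁻¹ ^ 2) *
        ∫⁻ s in Ioo 0 t, ENNReal.ofReal (Real.exp (-2 * lam * s)) *
          sobolevEnergy k (slabResidual ν T w s) := by
  have hΘ := isSpaceTimeTestOn_slabExtend_slabResidual (ν := ν) hT hw hK hwK
  rw [← lintegral_weight_sobolevEnergy_slabExtend_eq k _ ht.2]
  refine le_trans (le_of_eq ?_) (lintegral_weight_sobolevEnergy_heatDuhamelZero_le hν hlam k hΘ ht.1)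
  refine setLIntegral_congr_fun measurableSet_Ioo fun s hs ↦ ?_
  rw [eq_heatDuhamelZero_of_slabResidual hT hν hw hK hwK hw0 ⟨hs.1.le, hs.2.le.trans ht.2⟩]

/-- **Weighted gradient energy, integrated**:
`∫₀ᵗ e^{-2λs} Σᵢ E_k(∂ᵢw) ≤ (λ⁻¹/2ν) ∫₀ᵗ e^{-2λs} E_k(∂ₜw - νΔw)`. [cite: Evans2010, §7.1.2, Thm. 2] -/
theorem lintegral_weight_sum_sobolevEnergy_fderiv_le_residual {lam : ℝ} (hlam : 0 < lam) (k : ℕ)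
    {t : ℝ} (ht : t ∈ Icc 0 T) :
    ∫⁻ s in Ioo 0 t, ENNReal.ofReal (Real.exp (-2 * lam * s)) *
        ∑ i, sobolevEnergy k (fun x ↦ fderiv ℝ (w s) x (stdOrthonormalBasis ℝ E i)) ≤
      ENNReal.ofReal (lam⁻¹ / (2 * ν)) *
        ∫⁻ s in Ioo 0 t, ENNReal.ofReal (Real.exp (-2 * lam * s)) *
          sobolevEnergy k (slabResidual ν T w s) := by
  have hΘ := isSpaceTimeTestOn_slabExtend_slabResidual (ν := ν) hT hw hK hwK
  rw [← lintegral_weight_sobolevEnergy_slabExtend_eq k _ ht.2]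
  refine le_trans (le_of_eq ?_)
    (lintegral_weight_sum_sobolevEnergy_fderiv_heatDuhamelZero_le hν hlam k hΘ ht.1)
  refine setLIntegral_congr_fun measurableSet_Ioo fun s hs ↦ ?_
  rw [eq_heatDuhamelZero_of_slabResidual hT hν hw hK hwK hw0 ⟨hs.1.le, hs.2.le.trans ht.2⟩]

/-- **Weighted maximal regularity, integrated** (no `λ`-gain, `λ ≥ 0`):
`∫₀ᵗ e^{-2λs} Σᵢⱼ E_k(∂ⱼ∂ᵢw) ≤ (n/ν²) ∫₀ᵗ e^{-2λs} E_k(∂ₜw - νΔw)`.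
[cite: Evans2010, §7.1.3] -/
theorem lintegral_weight_sum_sobolevEnergy_fderiv_fderiv_le_residual {lam : ℝ} (hlam : 0 ≤ lam)
    (k : ℕ) {t : ℝ} (ht : t ∈ Icc 0 T) :
    ∫⁻ s in Ioo 0 t, ENNReal.ofReal (Real.exp (-2 * lam * s)) * ∑ i, ∑ j, sobolevEnergy k
        (fun x ↦ fderiv ℝ (fun y ↦ fderiv ℝ (w s) y (stdOrthonormalBasis ℝ E i)) x
          (stdOrthonormalBasis ℝ E j)) ≤
      ENNReal.ofReal ((Module.finrank ℝ E : ℝ) / ν ^ 2) *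
        ∫⁻ s in Ioo 0 t, ENNReal.ofReal (Real.exp (-2 * lam * s)) *
          sobolevEnergy k (slabResidual ν T w s) := by
  have hΘ := isSpaceTimeTestOn_slabExtend_slabResidual (ν := ν) hT hw hK hwK
  rw [← lintegral_weight_sobolevEnergy_slabExtend_eq k _ ht.2]
  refine le_trans (le_of_eq ?_)
    (lintegral_weight_sum_sobolevEnergy_fderiv_fderiv_heatDuhamelZero_le hν hlam k hΘ ht.1)
  refine setLIntegral_congr_fun measurableSet_Ioo fun s hs ↦ ?_
  rw [eq_heatDuhamelZero_of_slabResidual hT hν hw hK hwK hw0 ⟨hs.1.le, hs.2.le.trans ht.2⟩]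

/-- **Weighted energy, pointwise in time**: `e^{-2λt} E_k(w(t)) ≤ λ⁻¹ ∫₀ᵗ e^{-2λs} E_k(∂ₜw - νΔw)`.
[cite: Evans2010, §7.1.2, Thm. 2] -/
theorem weight_mul_sobolevEnergy_le_residual {lam : ℝ} (hlam : 0 < lam) (k : ℕ) {t : ℝ}
    (ht : t ∈ Icc 0 T) :
    ENNReal.ofReal (Real.exp (-2 * lam * t)) * sobolevEnergy k (w t) ≤
      ENNReal.ofReal lam⁻¹ *
        ∫⁻ s in Ioo 0 t, ENNReal.ofReal (Real.exp (-2 * lam * s)) *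
          sobolevEnergy k (slabResidual ν T w s) := by
  have hΘ := isSpaceTimeTestOn_slabExtend_slabResidual (ν := ν) hT hw hK hwK
  rw [← lintegral_weight_sobolevEnergy_slabExtend_eq k _ ht.2,
    eq_heatDuhamelZero_of_slabResidual hT hν hw hK hwK hw0 ht]
  exact weight_mul_sobolevEnergy_heatDuhamelZero_le hν hlam k hΘ ht.1

/-- **Weighted gradient energy, pointwise in time** (`λ ≥ 0`):
`e^{-2λt} Σᵢ E_k(∂ᵢw(t)) ≤ (n/ν) ∫₀ᵗ e^{-2λs} E_k(∂ₜw - νΔw)`. [cite: Evans2010, §7.1.3] -/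
theorem weight_mul_sum_sobolevEnergy_fderiv_le_residual {lam : ℝ} (hlam : 0 ≤ lam) (k : ℕ) {t : ℝ}
    (ht : t ∈ Icc 0 T) :
    ENNReal.ofReal (Real.exp (-2 * lam * t)) *
        ∑ i, sobolevEnergy k (fun x ↦ fderiv ℝ (w t) x (stdOrthonormalBasis ℝ E i)) ≤
      ENNReal.ofReal ((Module.finrank ℝ E : ℝ) / ν) *
        ∫⁻ s in Ioo 0 t, ENNReal.ofReal (Real.exp (-2 * lam * s)) *
          sobolevEnergy k (slabResidual ν T w s) := by
  have hΘ := isSpaceTimeTestOn_slabExtend_slabResidual (ν := ν) hT hw hK hwK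
  rw [← lintegral_weight_sobolevEnergy_slabExtend_eq k _ ht.2,
    eq_heatDuhamelZero_of_slabResidual hT hν hw hK hwK hw0 ht]
  exact weight_mul_sum_sobolevEnergy_fderiv_heatDuhamelZero_le hν hlam k hΘ ht.1

end Estimates

end Literature.Analysis.PDE

end
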